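import Literature.NumberTheory.LocalFields.UnramifiedQuadraticNormFibres        -- ★ p840590 (L5-c) FILE 2: `natCard_norm_fibre_quotient_pow`
import HarnessLib

/-!
# Product counts `|R ⧸ 𝔪^m| · #{norm fibre mod 𝔪^(2m+1)} = (q + 1) q^(4m)` for an unramified quadratic involution (Flicker 1998, Prop. 16)

Topic `NumberTheory/LocalFields`; namespace `Literature.NumberTheory.LocalFields.UnramifiedQuadraticNorm`.  THEOREMS ONLY (no definition, no instance, no notation,
no named fact, no `sorry`).  Cell `pub/hodgecm-mathlib`, F0∕P3a road «D-N7-inert» ∕ MAP v3 (F11-c) LAYER B′ (B-p14 (g30) ∕ A-p13 (g30)): the RESIDUE-COUNT CORE of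
«`[S : H′_m] = (q+1) q^{4m}`» (the index of the level-`m` stabiliser in the stabiliser of the base point of the building of `U(3)`, Flicker 1998 Prop. 16), in the
abstract currency of ★ (L5-c): a complete DVR `R` with involution `σ` moving some element by a unit (`IsUnit (σ a − a)`: the unramified quadratic situation) and residue
field of cardinality `q²`.  HC_CM is proved only modulo the printed citations until rung 0 closes; this file is unconditional.

* `natCard_quotient_maximalIdeal_pow_eq (m) : |R ⧸ 𝔪^m| = q^(2m)`;
* `natCard_norm_fibre_quotient_pow_two_mul_add_one (m) : #{x̄ ∈ R ⧸ 𝔪^(2m+1) : x̄ σ̄x̄ = r̄} = q^(2m) (q + 1)`;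
* **`natCard_quotient_pow_mul_natCard_norm_fibre (m) : |R ⧸ 𝔪^m| · #{x̄ ∈ R ⧸ 𝔪^(2m+1) : x̄ σ̄x̄ = r̄} = (q + 1) q^(4m)`** and the `Nat.card (_ × _)` form
  `natCard_quotient_pow_prod_norm_fibre`.

## References
* [Flicker1998UnitaryFL] Y. Z. Flicker, *Elementary proof of the fundamental lemma for a unitary group*, Canad. J. Math. 50 (1998), Prop. 16 p. 93.
* [Serre1979] J.-P. Serre, *Local Fields* (1979), Ch. V §2.
-/

set_option autoImplicit false

namespace Literature.NumberTheory.LocalFields.UnramifiedQuadraticNorm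

open IsLocalRing

universe u

variable {R : Type u} [CommRing R] (σ : R →+* R)

variable [IsDomain R] [IsDiscreteValuationRing R] [Finite (ResidueField R)] (hσ : ∀ a, σ (σ a) = a) {a : R} (ha : IsUnit (σ a - a))
  {q : ℕ} (hq : Nat.card (ResidueField R) = q ^ 2)

omit [Finite (ResidueField R)] in
include hq in
/-- `|R ⧸ 𝔪^m| = q^(2m)` when `|𝓀| = q²`. [cite: Serre1979, Ch. II §3] -/
theorem natCard_quotient_maximalIdeal_pow_eq (m : ℕ) : Nat.card (R ⧸ maximalIdeal R ^ m) = q ^ (2 * m) := by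
  rw [natCard_quotient_maximalIdeal_pow, hq, ← pow_mul]

include hσ ha hq in
/-- `#{x̄ ∈ R ⧸ 𝔪^(2m+1) : x̄ σ̄x̄ = r̄} = q^(2m) (q + 1)` (★ `natCard_norm_fibre_quotient_pow` at `k = 2m + 1`). [cite: Flicker1998UnitaryFL, Prop. 16 p. 93] [cite: Serre1979, Ch. V §2] -/
theorem natCard_norm_fibre_quotient_pow_two_mul_add_one [IsAdicComplete (maximalIdeal R) R] (m : ℕ) {r : R} (hr : IsUnit r) (hσr : σ r = r) :
    Nat.card {x : R ⧸ maximalIdeal R ^ (2 * m + 1) //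
      x * Ideal.quotientMap (maximalIdeal R ^ (2 * m + 1)) σ (maximalIdeal_pow_le_comap σ hσ (2 * m + 1)) x = Ideal.Quotient.mk _ r} =
      q ^ (2 * m) * (q + 1) := by
  rw [natCard_norm_fibre_quotient_pow σ hσ ha hq (by omega) hr hσr]
  rfl

include hσ ha hq in
/-- **THE RESIDUE-COUNT CORE OF `[S : H′_m] = (q + 1) q^(4m)`**: `|R ⧸ 𝔪^m| · #{x̄ ∈ R ⧸ 𝔪^(2m+1) : x̄ σ̄x̄ = r̄} = (q + 1) q^(4m)`.
[cite: Flicker1998UnitaryFL, Prop. 16 p. 93] -/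
theorem natCard_quotient_pow_mul_natCard_norm_fibre [IsAdicComplete (maximalIdeal R) R] (m : ℕ) {r : R} (hr : IsUnit r) (hσr : σ r = r) :
    Nat.card (R ⧸ maximalIdeal R ^ m) *
        Nat.card {x : R ⧸ maximalIdeal R ^ (2 * m + 1) //
          x * Ideal.quotientMap (maximalIdeal R ^ (2 * m + 1)) σ (maximalIdeal_pow_le_comap σ hσ (2 * m + 1)) x = Ideal.Quotient.mk _ r} =
      (q + 1) * q ^ (4 * m) := by
  rw [natCard_quotient_maximalIdeal_pow_eq hq, natCard_norm_fibre_quotient_pow_two_mul_add_one σ hσ ha hq m hr hσr]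
  ring

include hσ ha hq in
/-- The same as the cardinality of the product `(R ⧸ 𝔪^m) × {x̄ ∈ R ⧸ 𝔪^(2m+1) : x̄ σ̄x̄ = r̄}`. [cite: Flicker1998UnitaryFL, Prop. 16 p. 93] -/
theorem natCard_quotient_pow_prod_norm_fibre [IsAdicComplete (maximalIdeal R) R] (m : ℕ) {r : R} (hr : IsUnit r) (hσr : σ r = r) :
    Nat.card ((R ⧸ maximalIdeal R ^ m) ×
        {x : R ⧸ maximalIdeal R ^ (2 * m + 1) //
          x * Ideal.quotientMap (maximalIdeal R ^ (2 * m + 1)) σ (maximalIdeal_pow_le_comap σ hσ (2 * m + 1)) x = Ideal.Quotient.mk _ r}) =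
      (q + 1) * q ^ (4 * m) := by
  rw [Nat.card_prod, natCard_quotient_pow_mul_natCard_norm_fibre σ hσ ha hq m hr hσr]

omit [Finite (ResidueField R)] in
include hq in
/-- `|R ⧸ 𝔪^m| · |R ⧸ 𝔪^m| = q^(4m)` (two independent coordinates mod `𝔪^m`). [cite: Serre1979, Ch. II §3] -/
theorem natCard_quotient_pow_mul_self (m : ℕ) : Nat.card (R ⧸ maximalIdeal R ^ m) * Nat.card (R ⧸ maximalIdeal R ^ m) = q ^ (4 * m) := by
  rw [natCard_quotient_maximalIdeal_pow_eq hq, ← pow_add]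
  ring_nf

end Literature.NumberTheory.LocalFields.UnramifiedQuadraticNorm
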